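import Summits.HodgeConjecture.CorCM.MumfordTateRankTypeIVTimesTwoCMCurves
import HarnessLib

/-!
# `t(A × E' × E'') = t(A) + 2` for a `Θ`-rigid `A` with imaginary quadratic `End⁰A` and CM curves of two further fields; Ribet type `(g − 1, 1)`:
# `g² + 3`; the fivefold cell `T × E' × E'' = 12`; monotonicity `t(A) + 2 ≤ t((A × E' × E'') × Y)` (Moonen–Zarhin 1999 §3 (3.1), (3.6), (3.8))

COR-CM (cell `pub-hodgecm2`, seat `b27` gen 50, count-neutral Mumford–Tate-rank ladder; theorems only, no definition, no named fact;
UNCONDITIONAL — nothing here uses or asserts HC_CM).  Notation `t(X) = dim MT(H¹X)`.  Corollaries of `CorCM/MumfordTateRankTypeIVTimesTwoCMCurves`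
(`dim Lie Hg(H¹((A × E') × E'')) = dim Lie Hg(H¹(A × E')) + 1` and `Θ`-rigidity, for a `Θ`-rigid `A` with imaginary quadratic `End⁰A` and CM curves
`E'`, `E''` whose fields and `End⁰A` are pairwise without ring homomorphisms):

* **`mtRank_hodge_one_eq_add_two_of_isIsogenous_prod_cmCurves_of_rigid`** — `t(X) = t(A) + 2` for every `X ∼ A × (E' × E'')`
  (`t(A × E') = t(A) + 1` by Prop. (3.8), `CorCM/MumfordTateRankTimesCMCurve`);

* **`mtRank_hodge_one_of_isIsogenous_ribetTypeOne_prod_cmCurves_of_isEmpty`** — `dim A = g ≥ 3` of Ribet type `(g − 1, 1)`: `t = g² + 3`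
  (`Hg = U(g−1,1) × U(1) × U(1)`);
* **`mtRank_hodge_one_eq_twelve_of_isIsogenous_threefold_prod_cmCurves_of_isEmpty`** — `T` a simple abelian threefold with `dim_ℚ End⁰T = 2`:
  **`t(T × E' × E'') = 12`** (with `10`, `11` for coincident fields, `CorCM/MumfordTateRankTypeIVTimesCMCurveRigid`, this completes the column
  «simple type-IV(2,1) threefold × two CM elliptic curves»);
* **`mtRank_hodge_one_add_two_le_of_isIsogenous_prod_cmCurves_prod_of_rigid`** — `t(A) + 2 ≤ t(X)` for every `X ∼ (A × (E' × E'')) × Y`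
  (rigid-factor monotonicity, `CorCM/MumfordTateRankRigidMonotone`).

## References
* [MoonenZarhin1999LowDim] B. Moonen, Yu. G. Zarhin, *Hodge classes on abelian varieties of low dimension*, Math. Ann. 315 (1999), §3 (3.1),
  Lemma (3.6), Prop. (3.8), Thm. 0.1 (4) [corpus: paper:arxiv-math_9901113 pp. 1, 6–7]. [cite: MoonenZarhin1999LowDim, §3 (3.1), (3.6) and (3.8)]
* [Ribet1983] K. A. Ribet, Amer. J. Math. 105 (1983), Thm. 3. [cite: Ribet1983, Thm. 3]
-/

noncomputable section

open scoped TensorProduct BigOperators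
open CategoryTheory CategoryTheory.Limits Module

namespace Summit.HodgeConjecture.CorCM

open Literature.AlgebraicGeometry.Motives
open Literature.AlgebraicGeometry.Motives.AbelianVariety
open Literature.AlgebraicGeometry.Motives.HodgeStructure
open Literature.AlgebraicGeometry.HodgeTheory
open Literature.AlgebraicGeometry.ComplexMultiplication
open Literature.AlgebraicGeometry.Milne1999 (IsOfCMType)

variable [HodgeTensorFacts.{0, 0}] {X A C' C'' : AbelianVariety ℂ} {n n₁ : ℕ}

/-! ## §1 `t(A × E' × E'') = t(A) + 2` -/

/-- **`t(X) = t(A) + 2` for `X ∼ A × (E' × E'')`** — `A` with `0 < dim A`, `dim_ℚ End⁰A = 2`, `φ ∘ φ = −d`, `Θ`-rigid `H¹(A)`; `E'`, `E''` CM elliptic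
curves with NO ring homomorphisms `End⁰E' → End⁰A`, `End⁰E'' → End⁰A`, `End⁰E'' → End⁰E'` (three pairwise distinct imaginary quadratic fields).
(`t(A × E') = t(A) + 1` by Prop. (3.8) and §1.) [cite: MoonenZarhin1999LowDim, §3 (3.1), (3.6) and (3.8)] -/
theorem mtRank_hodge_one_eq_add_two_of_isIsogenous_prod_cmCurves_of_rigid (hX : IsSmoothProjective n X.X)
    (hA : IsSmoothProjective n₁ A.X) (hA0 : 0 < A.dim) (hA2 : Module.finrank ℚ A.endAlgebra = 2)
    (φ : A ⟶ A) {d : ℕ} (hd : 0 < d) (hφ : φ ≫ φ = -(d • 𝟙 A))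
    (hrigA : haveI := BettiUniverse.finite hA 1
      ∀ 𝔞 : Submodule ℚ (Module.End ℚ (bettiCohomology A.X 1)),
        𝔞 ≤ (BettiUniverse.hodge exists_isReal_hodgeModel_holds hA 1).hodgeLie →
        (∀ B ∈ 𝔞, ∀ B' ∈ 𝔞, B * B' - B' * B ∈ 𝔞) →
        (∃ Θ ∈ Submodule.span ℂ ((fun B : Module.End ℚ (bettiCohomology A.X 1) => B.baseChange ℂ) ''
            (𝔞 : Set (Module.End ℚ (bettiCohomology A.X 1)))),
          ∀ p, ∀ x ∈ (BettiUniverse.hodge exists_isReal_hodgeModel_holds hA 1).piece p (((1 : ℕ) : ℤ) - p),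
            Θ x = ((2 * p - ((1 : ℕ) : ℤ) : ℤ) : ℂ) • x) →
        (BettiUniverse.hodge exists_isReal_hodgeModel_holds hA 1).hodgeLie ≤ 𝔞)
    (hC'1 : C'.dim = 1) (hC'cm : IsOfCMType C') (hfor' : IsEmpty (C'.endAlgebra →+* A.endAlgebra))
    (hC''1 : C''.dim = 1) (hC''cm : IsOfCMType C'') (hfor'' : IsEmpty (C''.endAlgebra →+* A.endAlgebra))
    (hfor''' : IsEmpty (C''.endAlgebra →+* C'.endAlgebra)) (hXP : IsIsogenous X (A.prod (C'.prod C''))) :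
    haveI := BettiUniverse.finite hX 1
    haveI := BettiUniverse.finite hA 1
    (BettiUniverse.hodge exists_isReal_hodgeModel_holds hX 1).mtRank = (BettiUniverse.hodge exists_isReal_hodgeModel_holds hA 1).mtRank + 2 := by
  have hnA : A.dim = n₁ := schemeDim_eq_holds hA
  subst hnA
  haveI := BettiUniverse.finite hX 1
  haveI := BettiUniverse.finite hA 1
  have hP₁ : IsSmoothProjective (A.prod C').dim (A.prod C').X := AbelianVariety.isSmoothProjective_holds
  have hP : IsSmoothProjective ((A.prod C').prod C'').dim ((A.prod C').prod C'').X := AbelianVariety.isSmoothProjective_holds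
  haveI := BettiUniverse.finite hP₁ 1
  haveI := BettiUniverse.finite hP 1
  obtain ⟨χ', d', hd', hχ'⟩ := exists_hom_comp_self_eq_neg_of_cmCurve hC'1 hC'cm
  obtain ⟨χ'', d'', hd'', hχ''⟩ := exists_hom_comp_self_eq_neg_of_cmCurve hC''1 hC''cm
  have hfree' := forall_ne_sq_mul_of_isEmpty_ringHom hfor' (finrank_endAlgebra_eq_two_of_cmCurve hC'1 hC'cm) hd' hχ' hφ hd
  have hfree'' := forall_ne_sq_mul_of_isEmpty_ringHom hfor'' (finrank_endAlgebra_eq_two_of_cmCurve hC''1 hC''cm) hd'' hχ'' hφ hd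
  have hfree''' := forall_ne_sq_mul_of_isEmpty_ringHom hfor''' (finrank_endAlgebra_eq_two_of_cmCurve hC''1 hC''cm) hd'' hχ'' hχ' hd'
  obtain ⟨hfin, -⟩ := finrank_hodgeLie_eq_and_rigid_prod_cmCurve_prod_cmCurve hA hP₁ hP hA0 hA2 φ hd hφ hrigA hC'1 χ' hd' hχ' hC''1 χ''
    hd'' hχ'' hfree' hfree'' hfree'''
  have h1 := finrank_hodgeLie_hodge_one_prod_cmCurve_eq_add hA AbelianVariety.isSmoothProjective_holds hP₁ hA0 hA2 φ hd hφ hC'1 χ' hd' hχ'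
    (Or.inr hfree')
  have hE'1 : Module.finrank ℚ (BettiUniverse.hodge exists_isReal_hodgeModel_holds
      (AbelianVariety.isSmoothProjective_holds (A := C')) 1).hodgeLie = 1 := by
    have h2 := mtRank_hodge_one_eq_two_of_cm_curve hC'1 hC'cm
    rw [mtRank_hodge_one_eq_finrank_hodgeLie_add_one AbelianVariety.isSmoothProjective_holds (by omega)] at h2
    omega
  have hiso := finrank_hodgeLie_hodge_one_eq_of_isIsogenous hX hP
    (hXP.trans (Literature.AlgebraicGeometry.HodgeTheory.isIsogenous_prod_assoc A C' C'').symm')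
  have h0 : 0 < X.dim := by
    obtain ⟨f, hf⟩ := hXP
    rw [dim_eq_of_isIsogeny hf, dim_prod]; omega
  rw [mtRank_hodge_one_eq_finrank_hodgeLie_add_one hX h0, mtRank_hodge_one_eq_finrank_hodgeLie_add_one hA hA0, hiso, hfin, h1, hE'1]

/-! ## §2 Ribet type, the fivefold cell, monotonicity -/

/-- **Ribet type `(g − 1, 1)` × two CM curves of two further fields: `t(X) = g² + 3`** for `X ∼ A × (E' × E'')`, `dim A = g ≥ 3`, `End⁰A` an
imaginary quadratic field (`φ ∘ φ = −d`, multiplicity one at `± i√d`), `E'`, `E''` of CM type with `End⁰E' ↛ End⁰A`, `End⁰E'' ↛ End⁰A`,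
`End⁰E'' ↛ End⁰E'` (`Hg = U(g−1,1) × U(1) × U(1)`). [cite: MoonenZarhin1999LowDim, §3 (3.1) and (3.8)] [cite: Ribet1983, Thm. 3] -/
theorem mtRank_hodge_one_of_isIsogenous_ribetTypeOne_prod_cmCurves_of_isEmpty (hX : IsSmoothProjective n X.X) (hF : IsField A.endAlgebra)
    (hnR : ¬ NumberField.IsTotallyReal (EndField A hF)) (φ : A ⟶ A) {d : ℕ} (hd : 0 < d) (hφ : φ ≫ φ = -(d • 𝟙 A))
    (hA2 : Module.finrank ℚ A.endAlgebra = 2)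
    (h1 : eigenMultiplicity A φ (Complex.I * (Real.sqrt d : ℂ)) = 1 ∨ eigenMultiplicity A φ (-(Complex.I * (Real.sqrt d : ℂ))) = 1)
    (hdim : 3 ≤ A.dim) (hC'1 : C'.dim = 1) (hC'cm : IsOfCMType C') (hfor' : IsEmpty (C'.endAlgebra →+* A.endAlgebra))
    (hC''1 : C''.dim = 1) (hC''cm : IsOfCMType C'') (hfor'' : IsEmpty (C''.endAlgebra →+* A.endAlgebra))
    (hfor''' : IsEmpty (C''.endAlgebra →+* C'.endAlgebra)) (hXP : IsIsogenous X (A.prod (C'.prod C''))) :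
    haveI := BettiUniverse.finite hX 1
    (BettiUniverse.hodge exists_isReal_hodgeModel_holds hX 1).mtRank = A.dim * A.dim + 3 := by
  have hA : IsSmoothProjective A.dim A.X := AbelianVariety.isSmoothProjective_holds
  haveI := BettiUniverse.finite hX 1
  haveI := BettiUniverse.finite hA 1
  have hgg := (mtRank_hodge_one_of_ribetTypeOne' hA hF hnR φ hd hφ hA2 h1 hdim).1
  have h := mtRank_hodge_one_eq_add_two_of_isIsogenous_prod_cmCurves_of_rigid hX hA (by omega) hA2 φ hd hφ
    (hodgeLie_rigid_of_ribetTypeOne hA φ hd hφ hA2 h1 hdim) hC'1 hC'cm hfor' hC''1 hC''cm hfor'' hfor''' hXP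
  omega

/-- **THE FIVEFOLD CELL `t(T × E' × E'') = 12`**: `T` a simple abelian threefold with `dim_ℚ End⁰T = 2` (`End⁰T = k` imaginary quadratic,
`t(T) = 10`), `E'`, `E''` CM elliptic curves whose fields do not map to `k` nor to each other — `Hg(T × E' × E'') = U(2,1) × U(1) × U(1)`.
Compare `11` when one curve has field `k` and `10`/`11` for coincident fields (`CorCM/MumfordTateRankTypeIVTimesCMCurveRigid`).
[cite: MoonenZarhin1999LowDim, Thm. 0.1 (4), §3 (3.1) and (3.8)] -/
theorem mtRank_hodge_one_eq_twelve_of_isIsogenous_threefold_prod_cmCurves_of_isEmpty (hX : IsSmoothProjective n X.X)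
    {T : AbelianVariety ℂ} (hTs : T.IsSimple) (hT3 : T.dim = 3) (hTE : Module.finrank ℚ T.endAlgebra = 2)
    (hC'1 : C'.dim = 1) (hC'cm : IsOfCMType C') (hfor' : IsEmpty (C'.endAlgebra →+* T.endAlgebra))
    (hC''1 : C''.dim = 1) (hC''cm : IsOfCMType C'') (hfor'' : IsEmpty (C''.endAlgebra →+* T.endAlgebra))
    (hfor''' : IsEmpty (C''.endAlgebra →+* C'.endAlgebra)) (hXP : IsIsogenous X (T.prod (C'.prod C''))) :
    haveI := BettiUniverse.finite hX 1
    (BettiUniverse.hodge exists_isReal_hodgeModel_holds hX 1).mtRank = 12 := by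
  have hT : IsSmoothProjective T.dim T.X := AbelianVariety.isSmoothProjective_holds
  haveI := BettiUniverse.finite hX 1
  haveI := BettiUniverse.finite hT 1
  obtain ⟨φ, d, hd, hφ⟩ := exists_hom_comp_self_eq_neg_of_isSimple_threefold_of_finrank_eq_two hTs hT3 hTE
  have h10 : (BettiUniverse.hodge exists_isReal_hodgeModel_holds hT 1).mtRank = 10 :=
    (mtRank_hodge_one_of_isSimple_threefold_of_finrank_endAlgebra_eq_two hT hTs hT3 hTE).1
  have h := mtRank_hodge_one_eq_add_two_of_isIsogenous_prod_cmCurves_of_rigid hX hT (by omega) hTE φ hd hφ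
    (hodgeLie_rigid_of_isSimple_threefold_of_finrank_endAlgebra_eq_two hT hTs hT3 hTE) hC'1 hC'cm hfor' hC''1 hC''cm hfor'' hfor''' hXP
  omega

/-- **Monotonicity: `t(A) + 2 ≤ t(X)` for every `X ∼ (A × (E' × E'')) × Y`** (`A`, `E'`, `E''` as in
`mtRank_hodge_one_eq_add_two_of_isIsogenous_prod_cmCurves_of_rigid`; `Y` arbitrary): `H¹((A × E') × E'')` is `Θ`-rigid by §1, so the rigid-factor
monotonicity of `CorCM/MumfordTateRankRigidMonotone` applies. [cite: MoonenZarhin1999LowDim, §3 (3.1) and (3.8)] -/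
theorem mtRank_hodge_one_add_two_le_of_isIsogenous_prod_cmCurves_prod_of_rigid (hX : IsSmoothProjective n X.X)
    (hA : IsSmoothProjective n₁ A.X) (hA0 : 0 < A.dim) (hA2 : Module.finrank ℚ A.endAlgebra = 2)
    (φ : A ⟶ A) {d : ℕ} (hd : 0 < d) (hφ : φ ≫ φ = -(d • 𝟙 A))
    (hrigA : haveI := BettiUniverse.finite hA 1
      ∀ 𝔞 : Submodule ℚ (Module.End ℚ (bettiCohomology A.X 1)),
        𝔞 ≤ (BettiUniverse.hodge exists_isReal_hodgeModel_holds hA 1).hodgeLie →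
        (∀ B ∈ 𝔞, ∀ B' ∈ 𝔞, B * B' - B' * B ∈ 𝔞) →
        (∃ Θ ∈ Submodule.span ℂ ((fun B : Module.End ℚ (bettiCohomology A.X 1) => B.baseChange ℂ) ''
            (𝔞 : Set (Module.End ℚ (bettiCohomology A.X 1)))),
          ∀ p, ∀ x ∈ (BettiUniverse.hodge exists_isReal_hodgeModel_holds hA 1).piece p (((1 : ℕ) : ℤ) - p),
            Θ x = ((2 * p - ((1 : ℕ) : ℤ) : ℤ) : ℂ) • x) →
        (BettiUniverse.hodge exists_isReal_hodgeModel_holds hA 1).hodgeLie ≤ 𝔞)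
    (hC'1 : C'.dim = 1) (hC'cm : IsOfCMType C') (hfor' : IsEmpty (C'.endAlgebra →+* A.endAlgebra))
    (hC''1 : C''.dim = 1) (hC''cm : IsOfCMType C'') (hfor'' : IsEmpty (C''.endAlgebra →+* A.endAlgebra))
    (hfor''' : IsEmpty (C''.endAlgebra →+* C'.endAlgebra)) {Y : AbelianVariety ℂ}
    (hXP : IsIsogenous X ((A.prod (C'.prod C'')).prod Y)) :
    haveI := BettiUniverse.finite hX 1
    haveI := BettiUniverse.finite hA 1
    (BettiUniverse.hodge exists_isReal_hodgeModel_holds hA 1).mtRank + 2 ≤ (BettiUniverse.hodge exists_isReal_hodgeModel_holds hX 1).mtRank := by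
  have hnA : A.dim = n₁ := schemeDim_eq_holds hA
  subst hnA
  haveI := BettiUniverse.finite hX 1
  haveI := BettiUniverse.finite hA 1
  have hP₁ : IsSmoothProjective (A.prod C').dim (A.prod C').X := AbelianVariety.isSmoothProjective_holds
  have hP : IsSmoothProjective ((A.prod C').prod C'').dim ((A.prod C').prod C'').X := AbelianVariety.isSmoothProjective_holds
  haveI := BettiUniverse.finite hP₁ 1
  haveI := BettiUniverse.finite hP 1
  obtain ⟨χ', d', hd', hχ'⟩ := exists_hom_comp_self_eq_neg_of_cmCurve hC'1 hC'cm
  obtain ⟨χ'', d'', hd'', hχ''⟩ := exists_hom_comp_self_eq_neg_of_cmCurve hC''1 hC''cm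
  have hfree' := forall_ne_sq_mul_of_isEmpty_ringHom hfor' (finrank_endAlgebra_eq_two_of_cmCurve hC'1 hC'cm) hd' hχ' hφ hd
  have hfree'' := forall_ne_sq_mul_of_isEmpty_ringHom hfor'' (finrank_endAlgebra_eq_two_of_cmCurve hC''1 hC''cm) hd'' hχ'' hφ hd
  have hfree''' := forall_ne_sq_mul_of_isEmpty_ringHom hfor''' (finrank_endAlgebra_eq_two_of_cmCurve hC''1 hC''cm) hd'' hχ'' hχ' hd'
  obtain ⟨-, hrig⟩ := finrank_hodgeLie_eq_and_rigid_prod_cmCurve_prod_cmCurve hA hP₁ hP hA0 hA2 φ hd hφ hrigA hC'1 χ' hd' hχ' hC''1 χ''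
    hd'' hχ'' hfree' hfree'' hfree'''
  have hXQ : IsIsogenous X (((A.prod C').prod C'').prod Y) :=
    hXP.trans ((Literature.AlgebraicGeometry.HodgeTheory.isIsogenous_prod_assoc A C' C'').symm'.prod (IsIsogenous.refl Y))
  have hle := mtRank_hodge_one_le_of_isIsogenous_prod_of_rigid (X₂ := Y) hX hP (by rw [dim_prod, dim_prod]; omega) hrig hXQ
  have heq := mtRank_hodge_one_eq_add_two_of_isIsogenous_prod_cmCurves_of_rigid hP hA hA0 hA2 φ hd hφ hrigA hC'1 hC'cm hfor' hC''1
    hC''cm hfor'' hfor''' (Literature.AlgebraicGeometry.HodgeTheory.isIsogenous_prod_assoc A C' C'')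
  omega

end Summit.HodgeConjecture.CorCM

end
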